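import Mathlib
import HarnessLib
import Summits.ValiantsHypothesis.ValiantsHypothesis.Theses.MonotoneRestoration
import Summits.ValiantsHypothesis.ValiantsHypothesis.Theorems.MonotoneRestorationMonotoneRestorationQPSymmetricLB
import Literature.ModelTheory.FiniteModelTheory.DawarWilsenach2025Thm72
import Literature.Computability.AlgebraicComplexity.DawarWilsenach2025Proofs

/-!
# ValiantsHypothesis / MonotoneRestoration — `MonotoneRestorationQP`, line `Sketch`, stub W2a-1

Support file for crux item `stmt-ValiantsHypothesis-15886`
(`Summit.ValiantsHypothesis.ValiantsHypothesis.Theses.MonotoneRestoration.MonotoneRestorationQP`),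
line `Sketch`, stub `stub_nonInjective_noQPSymmetric`.

The NON-INJECTIVE-MAPS polynomial
`NI_n := Σ_{ψ : [n] → [n] not injective} ∏_i x_{i, ψ i} = ∏_i (Σ_j x_{ij}) − per_n`
(nonnegative coefficients, bisymmetric, degree `n`) has no quasi-polynomial-size square-symmetric
circuits over `ℂ`. Proof: the landed pipeline `stub_symmetricLB_of_linearCountingWidth`
(Dawar–Wilsenach 2025, proof of Thm 7.1 for an arbitrary family) applied to the pairs of
`C^k`-equivalent bipartite graphs with different numbers of perfect matchings of
`DawarWilsenach2025_thm72_family` (taken at `k + 2 ≥ 2` pebble pairs). At a `0/1` adjacency matrix,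
`NI_m` evaluates to `∏_v deg v − per(adjacency matrix)`; the permanents differ
(`eval_perPoly_adj_ne_of_card_perfectMatchings_ne`), while the degree products agree because
`≡^{C^2}` already matches degrees along a bijection (two rounds of the bijective pebble game,
`ckEquiv_exists_local_bijection`).

No new definitions.
-/

-- `Summit.ValiantsHypothesis.ValiantsHypothesis.…` is the tree's mandated single-conjunct layout
-- (Sub = Summit), so the duplicated namespace component is intended.
set_option linter.dupNamespace false

namespace Summit.ValiantsHypothesis.ValiantsHypothesis.Theorems

open Literature.Computability.AlgebraicComplexity
open Literature.ModelTheory.FiniteModelTheory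

/-- **Two rounds of the bijective pebble game.** If `X ≡^{C^k} Y` with `k ≥ 2`, then Duplicator's
first bijection `f` and, for each pebbled `a`, her second bijection `g_a` satisfy
`a ~ b ↔ f a ~ g_a b`; in particular `deg a = deg (f a)` (colour refinement is subsumed by `C^2`).
[cite: AtseriasDawar2019, §2.1] -/
theorem ckEquiv_exists_local_bijection {α β : Type*} {X : SimpleGraph α} {Y : SimpleGraph β}
    {k : ℕ} (h : CkEquiv k X Y) (hk : 2 ≤ k) :
    ∃ f : α ≃ β, ∀ a : α, ∃ g : α ≃ β, ∀ b : α, X.Adj a b ↔ Y.Adj (f a) (g b) := by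
  obtain ⟨S⟩ := h
  obtain ⟨f, hf⟩ := S.forth S.empty_mem (by rw [Set.ncard_empty]; omega)
  refine ⟨f, fun a => ?_⟩
  have ha : ({(a, f a)} : Set (α × β)) ∈ S.carrier := by
    rw [Set.singleton_def]
    exact hf a
  obtain ⟨g, hg⟩ := S.forth ha (by rw [Set.ncard_singleton]; omega)
  exact ⟨g, fun b => (S.isPartialIso_of_mem (hg b)).adj_iff
    (Set.mem_insert_of_mem _ (Set.mem_singleton _)) (Set.mem_insert _ _)⟩

open Classical in
/-- `C^2`-equivalent finite graphs have the same product of degrees (written as row sums of the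
`0/1` adjacency matrix). [folklore] -/
theorem ckEquiv_prod_degree_eq {α β : Type*} [Fintype α] [Fintype β] {X : SimpleGraph α}
    {Y : SimpleGraph β} {k : ℕ} (h : CkEquiv k X Y) (hk : 2 ≤ k) (R : Type*) [CommSemiring R] :
    ∏ a : α, ∑ b : α, (if X.Adj a b then (1 : R) else 0) =
      ∏ v : β, ∑ w : β, (if Y.Adj v w then (1 : R) else 0) := by
  obtain ⟨f, hf⟩ := ckEquiv_exists_local_bijection h hk
  rw [← f.prod_comp (fun v : β => ∑ w : β, (if Y.Adj v w then (1 : R) else 0))]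
  refine Fintype.prod_congr _ _ fun a => ?_
  obtain ⟨g, hg⟩ := hf a
  rw [← g.sum_comp (fun w : β => if Y.Adj (f a) w then (1 : R) else 0)]
  refine Fintype.sum_congr _ _ fun b => ?_
  rw [hg b]

/-- The generic permanent at a point `s`, as a sum over permutations of row-indexed products:
`per(s) = Σ_σ ∏_i s (i, σ i)`. [folklore] -/
theorem eval_perPoly_eq_sum_perm {m : ℕ} (R : Type*) [CommSemiring R] (s : Fin m × Fin m → R) :
    MvPolynomial.eval s (perPoly (Fin m) R) = ∑ σ : Equiv.Perm (Fin m), ∏ i, s (i, σ i) := by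
  rw [eval_perPoly, ← Matrix.permanent_transpose]
  simp [Matrix.permanent, Matrix.transpose_apply, Matrix.of_apply]

/-- The sum over permutations of `∏_i s(i, σ i)` is the sum over INJECTIVE maps `ψ : [m] → [m]`
(on a finite set injective self-maps are the permutations). [folklore] -/
theorem sum_perm_eq_sum_filter_injective {m : ℕ} (R : Type*) [CommSemiring R]
    (F : (Fin m → Fin m) → R) :
    ∑ σ : Equiv.Perm (Fin m), F σ =
      ∑ ψ ∈ (Finset.univ : Finset (Fin m → Fin m)).filter (fun ψ => Function.Injective ψ), F ψ := by
  rw [Finset.sum_subtype ((Finset.univ : Finset (Fin m → Fin m)).filter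
      (fun ψ => Function.Injective ψ)) (p := fun ψ => Function.Injective ψ) (by simp)]
  refine Fintype.sum_bijective (fun σ => ⟨σ, σ.injective⟩) ⟨?_, ?_⟩ _ _ (fun σ => rfl)
  · intro σ τ hστ
    exact Equiv.ext (congrFun (congrArg Subtype.val hστ))
  · rintro ⟨ψ, hψ⟩
    exact ⟨Equiv.ofBijective ψ (Finite.injective_iff_bijective.1 hψ), rfl⟩

/-- **Value of `NI_m`**: at any point `s`,
`NI_m(s) + per_m(s) = Σ_{all ψ} ∏_i s(i, ψ i) = ∏_i Σ_j s(i, j)`. [folklore] -/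
theorem eval_nonInjective_add_eval_perPoly {m : ℕ} (s : Fin m × Fin m → ℂ) :
    MvPolynomial.eval s (MvPolynomial.map (Complex.ofRealHom.comp NNReal.toRealHom)
      (∑ ψ : Fin m → Fin m, if Function.Injective ψ then (0 : MvPolynomial (Fin m × Fin m) NNReal)
        else ∏ i : Fin m, MvPolynomial.X (i, ψ i))) +
      MvPolynomial.eval s (perPoly (Fin m) ℂ) = ∏ i : Fin m, ∑ j : Fin m, s (i, j) := by
  -- push `map` and `eval` through the sum
  have h1 : MvPolynomial.eval s (MvPolynomial.map (Complex.ofRealHom.comp NNReal.toRealHom)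
      (∑ ψ : Fin m → Fin m, if Function.Injective ψ then (0 : MvPolynomial (Fin m × Fin m) NNReal)
        else ∏ i : Fin m, MvPolynomial.X (i, ψ i))) =
      ∑ ψ : Fin m → Fin m, if Function.Injective ψ then (0 : ℂ) else ∏ i : Fin m, s (i, ψ i) := by
    simp only [map_sum, apply_ite, map_zero, map_prod, MvPolynomial.map_X, MvPolynomial.eval_X]
  rw [h1, eval_perPoly_eq_sum_perm, sum_perm_eq_sum_filter_injective ℂ (fun ψ => ∏ i, s (i, ψ i)),
    Finset.sum_ite, Finset.sum_const_zero, zero_add, Finset.sum_filter_not_add_sum_filter,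
    Fintype.prod_sum]

open Classical in
/-- **Value of `NI_m` at an adjacency matrix**: `NI_m(A_X) = ∏_v deg_X v − per(A_X)`.
[folklore] -/
theorem eval_nonInjective_adj {m : ℕ} (X : SimpleGraph (Fin m)) :
    MvPolynomial.eval (fun ij : Fin m × Fin m => if X.Adj ij.1 ij.2 then (1 : ℂ) else 0)
      (MvPolynomial.map (Complex.ofRealHom.comp NNReal.toRealHom)
        (∑ ψ : Fin m → Fin m, if Function.Injective ψ then (0 : MvPolynomial (Fin m × Fin m) NNReal)
          else ∏ i : Fin m, MvPolynomial.X (i, ψ i))) =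
      (∏ a : Fin m, ∑ b : Fin m, (if X.Adj a b then (1 : ℂ) else 0)) -
        MvPolynomial.eval (fun ij : Fin m × Fin m => if X.Adj ij.1 ij.2 then (1 : ℂ) else 0)
          (perPoly (Fin m) ℂ) := by
  rw [eq_sub_iff_add_eq, eval_nonInjective_add_eval_perPoly]

open Classical in
/-- **Separation.** For `C^k`-equivalent (`k ≥ 2`) bipartite graphs with different numbers of
perfect matchings, `NI_m` takes different values at the two adjacency matrices: the degree
products agree and the permanents differ. [cite: DawarWilsenach2025, §7.1 (proof of Thm 7.1, p. 19)] -/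
theorem eval_nonInjective_adj_ne {m k : ℕ} {X Y : SimpleGraph (Fin m)}
    (hX : ∃ s t : Set (Fin m), X.IsBipartiteWith s t ∧ s ∪ t = Set.univ)
    (hY : ∃ s t : Set (Fin m), Y.IsBipartiteWith s t ∧ s ∪ t = Set.univ)
    (hXY : CkEquiv k X Y) (hk : 2 ≤ k)
    (hPM : Nat.card {M : X.Subgraph // M.IsPerfectMatching} ≠
      Nat.card {M : Y.Subgraph // M.IsPerfectMatching}) :
    MvPolynomial.eval (fun ij : Fin m × Fin m => if X.Adj ij.1 ij.2 then (1 : ℂ) else 0)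
      (MvPolynomial.map (Complex.ofRealHom.comp NNReal.toRealHom)
        (∑ ψ : Fin m → Fin m, if Function.Injective ψ then (0 : MvPolynomial (Fin m × Fin m) NNReal)
          else ∏ i : Fin m, MvPolynomial.X (i, ψ i))) ≠
    MvPolynomial.eval (fun ij : Fin m × Fin m => if Y.Adj ij.1 ij.2 then (1 : ℂ) else 0)
      (MvPolynomial.map (Complex.ofRealHom.comp NNReal.toRealHom)
        (∑ ψ : Fin m → Fin m, if Function.Injective ψ then (0 : MvPolynomial (Fin m × Fin m) NNReal)
          else ∏ i : Fin m, MvPolynomial.X (i, ψ i))) := by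
  obtain ⟨s, t, hXb, hst⟩ := hX
  obtain ⟨s', t', hYb, hst'⟩ := hY
  have hper := eval_perPoly_adj_ne_of_card_perfectMatchings_ne hXb hst hYb hst' ℂ hPM
  have hdeg := ckEquiv_prod_degree_eq hXY hk ℂ
  rw [eval_nonInjective_adj, eval_nonInjective_adj, hdeg]
  intro h
  exact hper (sub_right_injective h)

/-- W2a-1: the non-injective-maps polynomial `NI_n = ∏_i (Σ_j x_ij) - per_n` has no
quasi-polynomial square-symmetric circuits: its counting width is linear (the Thm 7.2 pairs
separate it, since `C^2`-equivalence preserves the degree product), so the symmetric lower-bound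
pipeline `stub_symmetricLB_of_linearCountingWidth` applies. [cite: DawarWilsenach2025, Thm 7.1] -/
theorem stub_nonInjective_noQPSymmetric : ¬ ∃ c : ℕ, ∀ n : ℕ, ∃ (G : Type) (_ : Fintype G)
      (C : LabelledArithCircuit ℂ (Fin n × Fin n) Unit G),
    C.IsSymmetric (Equiv.Perm (Fin n)) ∧
    C.eval (C.output ()) = MvPolynomial.map (Complex.ofRealHom.comp NNReal.toRealHom)
      (∑ ψ : Fin n → Fin n, if Function.Injective ψ then (0 : MvPolynomial (Fin n × Fin n) NNReal)
        else ∏ i : Fin n, MvPolynomial.X (i, ψ i)) ∧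
    Fintype.card G ≤ 2 ^ ((Nat.log 2 n + c) ^ c) := by
  classical
  refine stub_symmetricLB_of_linearCountingWidth
    (fun n => MvPolynomial.map (Complex.ofRealHom.comp NNReal.toRealHom)
      (∑ ψ : Fin n → Fin n, if Function.Injective ψ then (0 : MvPolynomial (Fin n × Fin n) NNReal)
        else ∏ i : Fin n, MvPolynomial.X (i, ψ i))) ?_
  obtain ⟨c₀, hc₀⟩ := CFIMatching.DawarWilsenach2025_thm72_family
  refine ⟨3 * c₀, fun k => ?_⟩
  obtain ⟨m, hm, X, Y, hX, hY, hXY, hPM⟩ := hc₀ (k + 2)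
  refine ⟨m, ?_, X, Y, hXY.mono (by omega), ?_⟩
  · have : c₀ * (k + 2) + c₀ = c₀ * k + 3 * c₀ := by ring
    nlinarith [this, Nat.zero_le (c₀ * k)]
  · have hind : ∀ Γ : SimpleGraph (Fin m),
        Set.indicator {ij : Fin m × Fin m | Γ.Adj ij.1 ij.2} (1 : Fin m × Fin m → ℂ) =
          fun ij : Fin m × Fin m => if Γ.Adj ij.1 ij.2 then (1 : ℂ) else 0 := by
      intro Γ
      funext ij
      by_cases h : Γ.Adj ij.1 ij.2 <;> simp [h]
    rw [hind X, hind Y]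
    exact eval_nonInjective_adj_ne hX hY hXY (by omega) hPM

end Summit.ValiantsHypothesis.ValiantsHypothesis.Theorems
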